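/-
Copyright (c) 2026 the pub-hodgecm-mathlib formalisation cell (harness21).  Prover seat hodgecm-mathlib-LH7-p05 (g3), Track B «K2-LIT» ∕ hLiu418 #184♮ =
`stmt-HodgeConjecture-24832`, socket #41 KIND 1 a♮ ∕ KIND W, the (dec) count road in the `D`-currency (K1a desk K2E5-p16 (g8) WORD #12, 2026-09-05T01:20Z):
brick (C-c) of K2Liu-p03 (g8)'s road (his PARALLELISM OFFER 01:27:24Z, taken 01:3xZ) — «THE MOVING KIND-W PLACE SET `U(S′,h′) ∖ T′` IS COUNTED BY HEIGHTS AND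
DENOMINATORS».  THEOREMS ONLY (no `def`, no `instance`, no notation, no named-fact hypothesis, no `sorry`); lane `--supports stmt-HodgeConjecture-24832 --as helper`.
-/
import Summits.HodgeConjecture.HodgeConjecture.Theorems.K2LiuSiegelEisensteinKindWLetters          -- ★ (x-a) `kindWPlaces` ∕ `kindWFinset` (the five-set definition)
import Summits.HodgeConjecture.HodgeConjecture.Theorems.K2LiuSiegelUnipotentCharacterFactorisation  -- ★ `map_adeleEval_eq_evalPlace` (`(u)_w = ((u_v))_w`, rfl)
import Summits.HodgeConjecture.HodgeConjecture.Theorems.K2LiuLocalHeightLevelConjugation            -- ★ `exists_localHeight_eq_pow` (`H_w = q_w^a`), `nnnorm_apply_le_localHeight`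
import Summits.HodgeConjecture.HodgeConjecture.Theorems.K2LiuKindWFinitePartLettersOfRecord         -- ★ `valuation_le_one_of_isIntegral`
import Summits.HodgeConjecture.HodgeConjecture.Theorems.K2LiuIdealPrimeCountLetter                  -- ★ p864063 `two_pow_card_le_absNorm` (primes of `(D)` vs `N((D)) = D^{[L:ℚ]}`)
import Literature.NumberTheory.Automorphic.AdelicHeightGLProofs                                     -- ★ `GLn.one_le_localHeight`
import Literature.NumberTheory.Automorphic.LeviEmbeddingGLHeight                                    -- ★ `GLn.hasFiniteMulSupport_localHeight`
import Literature.NumberTheory.Automorphic.ValuedFieldValuativeRelBridge                            -- ★ `mem_glInt_iff_forall_v_le_one`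
import HarnessLib

/-!
# Crux `HLiu418`, socket #41, KIND 1 a♮ ∕ KIND W (dec) — `K2LiuKindWPlacesCount`: THE MOVING BAD-PLACE SET IS COUNTED BY HEIGHTS AND DENOMINATORS
# `2^{#(kindWFinset T′ S′ h′ ∖ T′)} ≤ (∏ᶠ_w H_w(h′)) · (∏ᶠ_w H_w(w_Δ)) · D^{2[L:ℚ]}`

Cell `hodgecm-mathlib`, crux item hLiu418 = `stmt-HodgeConjecture-24832` (helper lane, count-neutral; closes no socket).  Namespace
`Summit.HodgeConjecture.HodgeConjecture.Cruxes.HLiu418.K2LiuKindWPlacesCount`.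

WHY.  The K1-a♮ (dec) letters in the `D`-currency of record (K1a desk WORD #12: every `S`-dependent count∕size letter reads
`∀ D, 1 ≤ D → (D·S integral) → ‖factor‖ ≤ C·H(h)^a·(1+τa S)^N·D^{N′}`) need ONE count of the moving part `Pm S h = T S h ∖ T₀` of the KIND-W exceptional set
`T S h = kindWFinset (T₀ ∪ T₁) S′ h′` (★ p863805 ∕ K2Liu-p03's ∃-free `htail_hsplit_of_cornerLetters`).  By ★ (x-a)'s DEFINITION `kindWPlaces T′ S′ h′ =
T′ ∪ {v : h′_v ∉ K_v} ∪ {v : (w_Δ)_v ∉ K_v} ∪ {v : some entry of S′ non-integral above v} ∪ {v : some entry of S′⁻¹ non-integral above v}`, the complement of `T′` is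
covered by four sets, each counted here — GENERICALLY (any CM datum `(e, dV, dW)`, any `T′`, any index `S′`, any point `h′`; no rank-one hypothesis):
* §1 tools: **`prod_le_finprod_of_one_le`** (a finite sub-product of a finitely supported product of reals `≥ 1` is below the full product);
  **`two_le_localHeight_of_one_lt`** (`H_w(g) > 1 ⇒ H_w(g) ≥ 2`, as `H_w = q_w^a` ★ `exists_localHeight_eq_pow`, `q_w ≥ 2`);
  **`exists_one_lt_localHeight_of_not_mem_localInt`** (`u_v ∉ K_v = U(J)(𝒪_v)` ⇒ some `w ∣ v` has `H_w(u) > 1`: ★ `mem_localInt_iff` + ★ `mem_glInt_iff_forall_v_le_one` +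
  ★ `map_adeleEval_eq_evalPlace` + ★ `nnnorm_apply_le_localHeight`); **`two_pow_card_le_finprod_localHeight`** (`2^{#{v ∈ A}} ≤ ∏ᶠ_w H_w(u)` when `u_v ∉ K_v` on `A`:
  distinct `v` have distinct witnesses `w ∣ v`); **`valuation_natCast_lt_one_of_one_lt`** (`D·y` integral and `|y|_w > 1` ⇒ `|D|_w < 1`);
  **`two_pow_card_le_pow_finrank_of_den`** (`2^{#{v : some entry of S non-integral above v}} ≤ D^{[L:ℚ]}` for a denominator `D` of `S`: those `v` lie under primes
  `w ∣ (D)` of `L`, counted by ★ p864063 `two_pow_card_le_absNorm` and `N_L((D)) = D^{[L:ℚ]}`).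
* §2 **`two_pow_card_kindWFinset_sdiff_le`** — the head displayed above, for `D ≠ 0` with `D·S′` and `D·S′⁻¹` `ℤ`-integral (for a singular index `S′⁻¹ = 0` and the second
  premise is free); consumer: K2Liu-p03 (g8)'s (C-d) `K2LiuKindOneSingularShellCount.pow_card_Pm_le_den` at `T′ := T₀ ∪ Trec ∪ den τ(σc S)`, `S′ := σc(S)E₁₁`,
  `h′ := Λ(γ[w S])·h` (then ★ `finprod_localHeight_le`: `∏ᶠ_w H_w(h′) ≤ (n+n)·‖h′‖`).
References: [BorelJacquet1979, §1.2 (heights on `GL_n(𝔸)`)]; [MoeglinWaldspurger1995, I.2.2]; [PlatonovRapinchuk1994, §5.1 (integral points `G(𝒪_v)`)];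
[NeukirchANT1999, Ch. I §3 Thm. (3.3), Ch. I §6 Prop. (6.1), Ch. I §8]; [KudlaRallis1994, §1]; [Tan1999, §2].
HONEST LABEL: HC_CM is proved only modulo the 7 printed citations (2 remaining named inputs: hLiu418 = stmt-HodgeConjecture-24832, h413 = stmt-HodgeConjecture-24833) until
rung 0 closes; count-neutral helper (`--supports stmt-HodgeConjecture-24832 --as helper`), closes no socket, moves no counter.
-/

set_option autoImplicit false
set_option linter.dupNamespace false -- the mandated namespace repeats `HodgeConjecture.HodgeConjecture`

noncomputable section

open scoped Matrix NNReal
open NumberField IsDedekindDomain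
open Literature.NumberTheory.Automorphic Literature.NumberTheory.GaloisRepresentations
open Literature.NumberTheory.GelbartRogawski1991 Literature.NumberTheory.GelbartRogawski1991.GRConstruction
open Literature.NumberTheory.K2Lit.SiegelDoubled
open Summit.HodgeConjecture.HodgeConjecture.Cruxes.HLiu418.K2LiuSiegelEisensteinKindWLetters
open Summit.HodgeConjecture.HodgeConjecture.Cruxes.HLiu418.K2LiuSiegelUnipotentCharacterFactorisation (map_adeleEval_eq_evalPlace)
open Summit.HodgeConjecture.HodgeConjecture.Cruxes.HLiu418.K2LiuLocalHeightLevelConjugation (exists_localHeight_eq_pow nnnorm_apply_le_localHeight)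
open Summit.HodgeConjecture.HodgeConjecture.Cruxes.HLiu418.K2LiuKindWFinitePartLettersOfRecord (valuation_le_one_of_isIntegral)
open Summit.HodgeConjecture.HodgeConjecture.Cruxes.HLiu418.K2LiuIdealPrimeCountLetter (two_pow_card_le_absNorm)

namespace Summit.HodgeConjecture.HodgeConjecture.Cruxes.HLiu418.K2LiuKindWPlacesCount

/-! ## §1 Tools -/

section Tools

/-- A finite sub-product of a finitely supported product of reals `≥ 1` is at most the full finite product. [folklore] -/
theorem prod_le_finprod_of_one_le {α : Type*} {f : α → ℝ} (hf : f.HasFiniteMulSupport) (h1 : ∀ a, 1 ≤ f a) (s : Finset α) :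
    ∏ a ∈ s, f a ≤ ∏ᶠ a, f a := by
  classical
  calc ∏ a ∈ s, f a ≤ ∏ a ∈ s ∪ hf.toFinset, f a :=
        Finset.prod_le_prod_of_subset_of_one_le Finset.subset_union_left (fun a _ => zero_le_one.trans (h1 a)) fun a _ _ => h1 a
    _ = ∏ᶠ a, f a := (finprod_eq_prod_of_mulSupport_subset _ fun a ha =>
        Finset.mem_coe.2 (Finset.mem_union_right _ (hf.mem_toFinset.2 ha))).symm

variable (L : Type) [Field L] [NumberField L]

/-- **`H_w(g) > 1 ⇒ H_w(g) ≥ 2`**: the local height is a power `q_w^a` of the residue cardinality (★ `exists_localHeight_eq_pow`), and `q_w ≥ 2`.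
[cite: BorelJacquet1979, §1.2] [cite: MoeglinWaldspurger1995, I.2.2] -/
theorem two_le_localHeight_of_one_lt {N : ℕ} [NeZero N] (w : HeightOneSpectrum (𝓞 L)) (g : GL (Fin N) (AdeleRing (𝓞 L) L))
    (h : 1 < GLn.localHeight N L w g) : (2 : ℝ) ≤ (GLn.localHeight N L w g : ℝ) := by
  obtain ⟨a, ha⟩ := exists_localHeight_eq_pow L (w := w) g
  have ha0 : a ≠ 0 := by
    rintro rfl
    rw [ha, pow_zero] at h
    exact lt_irrefl _ h
  have h2 : (2 : ℝ) ≤ ((Ideal.absNorm w.asIdeal : ℕ) : ℝ) := by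
    exact_mod_cast Literature.NumberTheory.LFunctions.AbelianDensity.two_le_absNorm L w
  rw [ha, NNReal.coe_pow, NNReal.coe_natCast]
  calc (2 : ℝ) = 2 ^ 1 := (pow_one _).symm
    _ ≤ ((Ideal.absNorm w.asIdeal : ℕ) : ℝ) ^ 1 := by rw [pow_one, pow_one]; exact h2
    _ ≤ ((Ideal.absNorm w.asIdeal : ℕ) : ℝ) ^ a := pow_le_pow_right₀ (one_le_two.trans h2) (Nat.one_le_iff_ne_zero.2 ha0)

/-- **`D·y` INTEGRAL AND `|y|_w > 1` FORCE `|D|_w < 1`** (so a place where an entry of `S` is non-integral divides every denominator of `S`).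
[cite: NeukirchANT1999, Ch. I §3 Thm. (3.3)] -/
theorem valuation_natCast_lt_one_of_one_lt (w : HeightOneSpectrum (𝓞 L)) {D : ℕ} {y : L} (hy : IsIntegral ℤ ((D : L) * y))
    (h1 : 1 < w.valuation L y) : w.valuation L (D : L) < 1 := by
  have hle : w.valuation L ((D : L) * y) ≤ 1 := valuation_le_one_of_isIntegral L w hy
  rw [map_mul] at hle
  by_contra hD
  rw [not_lt] at hD
  have : w.valuation L y < w.valuation L y :=
    calc w.valuation L y ≤ w.valuation L (D : L) * w.valuation L y := le_mul_of_one_le_left' hD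
      _ ≤ 1 := hle
      _ < w.valuation L y := h1
  exact lt_irrefl _ this

/-- **`2^{#C} ≤ D^{[L:ℚ]}` FOR THE DENOMINATOR PLACES OF A MATRIX**: if `D ≠ 0`, `D · S` has `ℤ`-integral entries, and every `v ∈ C` (a finset of finite places of
`L⁺`) has a place `w ∣ v` of `L` above which some entry of `S` is NOT integral, then `2^{#C} ≤ D^{[L:ℚ]}` — each such `w` divides `(D)` (`valuation_natCast_lt_one_of_one_lt`),
distinct `v` give distinct `w`, and the primes of `L` dividing `(D)` number at most `log₂ N_L((D)) = log₂ D^{[L:ℚ]}` (★ p864063 `two_pow_card_le_absNorm`, Mathlib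
`Ideal.absNorm_span_natCast`). [cite: NeukirchANT1999, Ch. I §3 Thm. (3.3); Ch. I §6 Prop. (6.1); Ch. I §8] -/
theorem two_pow_card_le_pow_finrank_of_den {N : ℕ} (S : Matrix (Fin N) (Fin N) L) {D : ℕ} (hD : D ≠ 0) (hS : ∀ i j, IsIntegral ℤ ((D : L) * S i j))
    (C : Finset (HeightOneSpectrum (𝓞 (Fp L))))
    (hC : ∀ v ∈ C, ∃ (w : UnitaryGroup.PlacesOver L v) (i j : Fin N), ((S i j : L) : w.1.adicCompletion L) ∉ w.1.adicCompletionIntegers L) :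
    (2 : ℝ) ^ C.card ≤ (D : ℝ) ^ Module.finrank ℚ L := by
  classical
  -- the primes of `L` dividing `(D)`
  have hI : Ideal.span {(D : 𝓞 L)} ≠ ⊥ := by
    rw [Ne, Ideal.span_singleton_eq_bot]
    exact_mod_cast hD
  set W : Finset (HeightOneSpectrum (𝓞 L)) := (Ideal.finite_factors hI).toFinset with hW
  have hWmem : ∀ w : HeightOneSpectrum (𝓞 L), w ∈ W ↔ w.asIdeal ∣ Ideal.span {(D : 𝓞 L)} := fun w => by
    rw [hW, Set.Finite.mem_toFinset, Set.mem_setOf_eq]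
  -- every `v ∈ C` lies under some `w ∈ W`
  have hsub : C ⊆ W.image fun w => w.under (𝓞 (Fp L)) := by
    intro v hv
    obtain ⟨w, i, j, hij⟩ := hC v hv
    refine Finset.mem_image.2 ⟨w.1, (hWmem w.1).2 ?_, w.2⟩
    -- `|S i j|_w > 1`, `D · S i j` integral ⇒ `|D|_w < 1` ⇒ `w ∣ (D)`
    have h1 : 1 < w.1.valuation L (S i j) := by
      rw [HeightOneSpectrum.mem_adicCompletionIntegers, HeightOneSpectrum.valuedAdicCompletion_eq_valuation', not_le] at hij
      exact hij
    have hlt := valuation_natCast_lt_one_of_one_lt L w.1 (hS i j) h1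
    rw [show ((D : ℕ) : L) = algebraMap (𝓞 L) L (D : 𝓞 L) by rw [map_natCast]] at hlt
    exact (HeightOneSpectrum.valuation_lt_one_iff_dvd w.1 (D : 𝓞 L)).1 hlt
  have hcard : C.card ≤ W.card := (Finset.card_le_card hsub).trans Finset.card_image_le
  -- `2^{#W} ≤ N((D)) = D^{[L:ℚ]}`
  have h2 : 2 ^ W.card ≤ D ^ Module.finrank ℚ L := by
    have h := two_pow_card_le_absNorm hI W fun w hw => (hWmem w).1 hw
    rwa [Ideal.absNorm_span_natCast, RingOfIntegers.rank] at h
  calc (2 : ℝ) ^ C.card ≤ (2 : ℝ) ^ W.card := pow_le_pow_right₀ one_le_two hcard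
    _ ≤ (D : ℝ) ^ Module.finrank ℚ L := by exact_mod_cast h2

variable [IsCMField L]
variable {N M n : ℕ} (e : Fin N × Fin M ≃ Fin n)
  (dV : Fin N → L) (hdV : ∀ i, IsCMField.complexConj L (dV i) = dV i)
  (dW : Fin M → L) (hdW : ∀ i, IsCMField.complexConj L (dW i) = dW i)

/-- **`u_v ∉ K_v ⇒ H_w(u) > 1` FOR SOME `w ∣ v`**: the integral points `K_v = U(J)(𝒪_v)` are cut out fibrewise by `u_w ∈ GL(𝒪_w)` for all `w ∣ v` (★ `mem_localInt_iff`), i.e. by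
`|entries of u_w|_w ≤ 1` and `|entries of u_w⁻¹|_w ≤ 1` (★ `mem_glInt_iff_forall_v_le_one`) — which `H_w(u) ≤ 1` grants (★ `nnnorm_apply_le_localHeight`; `u_w` IS the `w`-component
of the adelic matrix of `u`, ★ `map_adeleEval_eq_evalPlace`). [cite: PlatonovRapinchuk1994, §5.1] [cite: BorelJacquet1979, §1.2] -/
theorem exists_one_lt_localHeight_of_not_mem_localInt (u : HA L e dV hdV dW hdW) (v : HeightOneSpectrum (𝓞 (Fp L)))
    (hv : UnitaryGroup.evalPlace (Fp L) L (IsCMField.complexConj L) (n + n) (hermD L e dV hdV dW hdW) v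
        (UnitaryGroup.finPart (Fp L) L (IsCMField.complexConj L) (n + n) (hermD L e dV hdV dW hdW) u) ∉
      UnitaryGroup.localInt L (IsCMField.complexConj L) (n + n) (hermD L e dV hdV dW hdW) v) :
    ∃ w : UnitaryGroup.PlacesOver L v, 1 < GLn.localHeight (n + n) L w.1 (u : GL (Fin (n + n)) (AdeleRing (𝓞 L) L)) := by
  by_contra hex
  have hall : ∀ w : UnitaryGroup.PlacesOver L v, GLn.localHeight (n + n) L w.1 (u : GL (Fin (n + n)) (AdeleRing (𝓞 L) L)) ≤ 1 :=
    fun w => not_lt.1 fun hw => hex ⟨w, hw⟩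
  apply hv
  rw [UnitaryGroup.mem_localInt_iff]
  intro w
  -- the `w`-component of the adelic matrix of `u` IS `(u_v)_w`
  have hGL : Matrix.GeneralLinearGroup.map (AdelicGroupData.adeleEval L w.1) (u : GL (Fin (n + n)) (AdeleRing (𝓞 L) L)) =
      ((UnitaryGroup.evalPlace (Fp L) L (IsCMField.complexConj L) (n + n) (hermD L e dV hdV dW hdW) v
          (UnitaryGroup.finPart (Fp L) L (IsCMField.complexConj L) (n + n) (hermD L e dV hdV dW hdW) u) :
        UnitaryGroup.localPi L (IsCMField.complexConj L) (n + n) (hermD L e dV hdV dW hdW) v) : UnitaryGroup.LocalGLPi L (n + n) v) w := by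
    exact Units.ext (map_adeleEval_eq_evalPlace L e dV hdV dW hdW (v := v) u w)
  rw [← hGL, mem_glInt_iff_forall_v_le_one]
  have hH := hall w
  refine ⟨fun i j => ?_, fun i j => ?_⟩
  · have h1 := ((nnnorm_apply_le_localHeight L (w := w.1) (u : GL (Fin (n + n)) (AdeleRing (𝓞 L) L)) i j).1).trans hH
    rw [← Valued.toNormedField.norm_le_one_iff, ← coe_nnnorm, ← NNReal.coe_one, NNReal.coe_le_coe]
    exact h1
  · have h1 := ((nnnorm_apply_le_localHeight L (w := w.1) (u : GL (Fin (n + n)) (AdeleRing (𝓞 L) L)) i j).2).trans hH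
    rw [← Valued.toNormedField.norm_le_one_iff, ← coe_nnnorm, ← NNReal.coe_one, NNReal.coe_le_coe]
    exact h1

/-- **`2^{#A} ≤ ∏ᶠ_w H_w(u)` WHEN `u_v ∉ K_v` ON `A`** (`n ≠ 0`): choose for each `v ∈ A` a witness `w(v) ∣ v` with `H_{w(v)}(u) ≥ 2`
(`exists_one_lt_localHeight_of_not_mem_localInt`, `two_le_localHeight_of_one_lt`); `v ↦ w(v)` is injective (`w(v)` lies over `v`), so `2^{#A} ≤ ∏_{w ∈ w(A)} H_w(u) ≤ ∏ᶠ_w H_w(u)`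
(all `H_w ≥ 1`, ★ `GLn.one_le_localHeight`; finitely supported, ★ `GLn.hasFiniteMulSupport_localHeight`). [cite: BorelJacquet1979, §1.2] [cite: MoeglinWaldspurger1995, I.2.2] -/
theorem two_pow_card_le_finprod_localHeight [NeZero n] (u : HA L e dV hdV dW hdW) (A : Finset (HeightOneSpectrum (𝓞 (Fp L))))
    (hA : ∀ v ∈ A, UnitaryGroup.evalPlace (Fp L) L (IsCMField.complexConj L) (n + n) (hermD L e dV hdV dW hdW) v
        (UnitaryGroup.finPart (Fp L) L (IsCMField.complexConj L) (n + n) (hermD L e dV hdV dW hdW) u) ∉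
      UnitaryGroup.localInt L (IsCMField.complexConj L) (n + n) (hermD L e dV hdV dW hdW) v) :
    (2 : ℝ) ^ A.card ≤ ∏ᶠ w, (GLn.localHeight (n + n) L w (u : GL (Fin (n + n)) (AdeleRing (𝓞 L) L)) : ℝ) := by
  classical
  haveI : NeZero (n + n) := ⟨by have := NeZero.ne n; omega⟩
  set g : GL (Fin (n + n)) (AdeleRing (𝓞 L) L) := (u : GL (Fin (n + n)) (AdeleRing (𝓞 L) L)) with hg
  -- witnesses
  have hwit : ∀ v ∈ A, ∃ w : UnitaryGroup.PlacesOver L v, (2 : ℝ) ≤ (GLn.localHeight (n + n) L w.1 g : ℝ) := fun v hv => by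
    obtain ⟨w, hw⟩ := exists_one_lt_localHeight_of_not_mem_localInt L e dV hdV dW hdW u v (hA v hv)
    exact ⟨w, two_le_localHeight_of_one_lt L w.1 g hw⟩
  choose! wv hwv using hwit
  -- the witness map `v ↦ w(v)` on `A`, injective (its left inverse is `under`)
  set f : HeightOneSpectrum (𝓞 (Fp L)) → HeightOneSpectrum (𝓞 L) := fun v => (wv v).1 with hf
  have hinj : Set.InjOn f A := by
    intro v hv v' hv' hvv
    have h1 : (f v).under (𝓞 (Fp L)) = v := (wv v).2
    have h2 : (f v').under (𝓞 (Fp L)) = v' := (wv v').2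
    rw [← h1, ← h2, hvv]
  have hcard : (A.image f).card = A.card := Finset.card_image_of_injOn hinj
  have h1 : ∀ w, (1 : ℝ) ≤ (GLn.localHeight (n + n) L w g : ℝ) := fun w => by exact_mod_cast GLn.one_le_localHeight w g
  calc (2 : ℝ) ^ A.card = ∏ _w ∈ A.image f, (2 : ℝ) := by rw [Finset.prod_const, hcard]
    _ ≤ ∏ w ∈ A.image f, (GLn.localHeight (n + n) L w g : ℝ) := by
        refine Finset.prod_le_prod (fun _ _ => zero_le_two) fun w hw => ?_
        obtain ⟨v, hv, rfl⟩ := Finset.mem_image.1 hw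
        exact hwv v hv
    _ ≤ ∏ᶠ w, (GLn.localHeight (n + n) L w g : ℝ) := prod_le_finprod_of_one_le (GLn.hasFiniteMulSupport_localHeight g) h1 _

end Tools

/-! ## §2 The head: the moving KIND-W place set is counted by heights and denominators -/

section Head

variable (L : Type) [Field L] [NumberField L] [IsCMField L]
variable {N M n : ℕ} (e : Fin N × Fin M ≃ Fin n)
  (dV : Fin N → L) (hdV : ∀ i, IsCMField.complexConj L (dV i) = dV i)
  (dW : Fin M → L) (hdW : ∀ i, IsCMField.complexConj L (dW i) = dW i)

set_option maxHeartbeats 800000 in -- MEASURED on the farm: `whnf` of the STATEMENT (the `kindWFinset`∕`HA`∕`weylDelta` telescope) times out at 200000 and 400000, passes at 800000 (= ★ p863805's class)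
/-- **THE MOVING KIND-W PLACE SET IS COUNTED BY HEIGHTS AND DENOMINATORS.**  For any finset `T′` of finite places of `L⁺`, any index `S′ ∈ M_n(L)`, any point `h′ ∈ H(𝔸)`
and any natural `D ≠ 0` with `D·S′` and `D·S′⁻¹` `ℤ`-integral (for a singular `S′`, `S′⁻¹ = 0` and the second premise is free):
`2^{#(kindWFinset T′ S′ h′ ∖ T′)} ≤ (∏ᶠ_w H_w(h′)) · (∏ᶠ_w H_w(w_Δ)) · D^{2[L:ℚ]}`.
By ★ (x-a)'s definition `kindWPlaces T′ S′ h′ = T′ ∪ {h′_v ∉ K_v} ∪ {(w_Δ)_v ∉ K_v} ∪ {S′ non-integral above v} ∪ {S′⁻¹ non-integral above v}`, the complement of `T′` is covered by four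
finsets, counted by §1: `2^{#A} ≤ ∏ᶠ H_w(h′)`, `2^{#B} ≤ ∏ᶠ H_w(w_Δ)`, `2^{#C₁}, 2^{#C₂} ≤ D^{[L:ℚ]}`.  (Then ★ `finprod_localHeight_le`: `∏ᶠ_w H_w(g) ≤ (n+n)·‖g‖`.)
[cite: KudlaRallis1994, §1] [cite: Tan1999, §2] [cite: BorelJacquet1979, §1.2] [cite: PlatonovRapinchuk1994, §5.1] [cite: NeukirchANT1999, Ch. I §3 Thm. (3.3); Ch. I §6 Prop. (6.1)] -/
theorem two_pow_card_kindWFinset_sdiff_le [NeZero n] [DecidableEq (HeightOneSpectrum (𝓞 (Fp L)))]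
    (T' : Finset (HeightOneSpectrum (𝓞 (Fp L)))) (S' : Matrix (Fin n) (Fin n) L) (h' : HA L e dV hdV dW hdW)
    {D : ℕ} (hD : D ≠ 0) (hS : ∀ i j, IsIntegral ℤ ((D : L) * S' i j)) (hSi : ∀ i j, IsIntegral ℤ ((D : L) * S'⁻¹ i j)) :
    (2 : ℝ) ^ (kindWFinset L e dV hdV dW hdW T' S' h' \ T').card ≤
      (∏ᶠ w, (GLn.localHeight (n + n) L w (h' : GL (Fin (n + n)) (AdeleRing (𝓞 L) L)) : ℝ)) *
        (∏ᶠ w, (GLn.localHeight (n + n) L w (weylDelta L e dV hdV dW hdW : GL (Fin (n + n)) (AdeleRing (𝓞 L) L)) : ℝ)) *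
          (D : ℝ) ^ (2 * Module.finrank ℚ L) := by
  classical
  set K := kindWFinset L e dV hdV dW hdW T' S' h' \ T' with hK
  -- the four covering finsets
  set A := K.filter fun v => UnitaryGroup.evalPlace (Fp L) L (IsCMField.complexConj L) (n + n) (hermD L e dV hdV dW hdW) v
        (UnitaryGroup.finPart (Fp L) L (IsCMField.complexConj L) (n + n) (hermD L e dV hdV dW hdW) h') ∉
      UnitaryGroup.localInt L (IsCMField.complexConj L) (n + n) (hermD L e dV hdV dW hdW) v with hAdef
  set B := K.filter fun v => UnitaryGroup.evalPlace (Fp L) L (IsCMField.complexConj L) (n + n) (hermD L e dV hdV dW hdW) v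
        (UnitaryGroup.finPart (Fp L) L (IsCMField.complexConj L) (n + n) (hermD L e dV hdV dW hdW) (weylDelta L e dV hdV dW hdW)) ∉
      UnitaryGroup.localInt L (IsCMField.complexConj L) (n + n) (hermD L e dV hdV dW hdW) v with hBdef
  set C₁ := K.filter fun v => ∃ (w : UnitaryGroup.PlacesOver L v) (i j : Fin n), ((S' i j : L) : w.1.adicCompletion L) ∉ w.1.adicCompletionIntegers L
    with hC₁def
  set C₂ := K.filter fun v => ∃ (w : UnitaryGroup.PlacesOver L v) (i j : Fin n), ((S'⁻¹ i j : L) : w.1.adicCompletion L) ∉ w.1.adicCompletionIntegers L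
    with hC₂def
  -- the cover `K ⊆ A ∪ B ∪ C₁ ∪ C₂` (★ (x-a)'s definition of `kindWPlaces`, off `T′`)
  have hcover : K ⊆ ((A ∪ B) ∪ C₁) ∪ C₂ := by
    intro v hv
    have hvK := hv
    rw [hK, Finset.mem_sdiff, mem_kindWFinset] at hv
    obtain ⟨hmem, hT⟩ := hv
    unfold kindWPlaces at hmem
    rcases hmem with (((h0 | hA) | hB) | hC) | hC'
    · exact absurd (Finset.mem_coe.1 h0) hT
    · exact Finset.mem_union_left _ (Finset.mem_union_left _ (Finset.mem_union_left _ (Finset.mem_filter.2 ⟨hvK, hA⟩)))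
    · exact Finset.mem_union_left _ (Finset.mem_union_left _ (Finset.mem_union_right _ (Finset.mem_filter.2 ⟨hvK, hB⟩)))
    · exact Finset.mem_union_left _ (Finset.mem_union_right _ (Finset.mem_filter.2 ⟨hvK, hC⟩))
    · exact Finset.mem_union_right _ (Finset.mem_filter.2 ⟨hvK, hC'⟩)
  have hcard : K.card ≤ A.card + B.card + C₁.card + C₂.card :=
    (Finset.card_le_card hcover).trans
      ((Finset.card_union_le _ _).trans (Nat.add_le_add_right ((Finset.card_union_le _ _).trans (Nat.add_le_add_right (Finset.card_union_le _ _) _)) _))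
  -- the four counts
  have hA : (2 : ℝ) ^ A.card ≤ ∏ᶠ w, (GLn.localHeight (n + n) L w (h' : GL (Fin (n + n)) (AdeleRing (𝓞 L) L)) : ℝ) :=
    two_pow_card_le_finprod_localHeight L e dV hdV dW hdW h' A fun v hv => (Finset.mem_filter.1 hv).2
  have hB : (2 : ℝ) ^ B.card ≤ ∏ᶠ w, (GLn.localHeight (n + n) L w (weylDelta L e dV hdV dW hdW : GL (Fin (n + n)) (AdeleRing (𝓞 L) L)) : ℝ) :=
    two_pow_card_le_finprod_localHeight L e dV hdV dW hdW (weylDelta L e dV hdV dW hdW) B fun v hv => (Finset.mem_filter.1 hv).2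
  have hC₁ : (2 : ℝ) ^ C₁.card ≤ (D : ℝ) ^ Module.finrank ℚ L :=
    two_pow_card_le_pow_finrank_of_den L S' hD hS C₁ fun v hv => (Finset.mem_filter.1 hv).2
  have hC₂ : (2 : ℝ) ^ C₂.card ≤ (D : ℝ) ^ Module.finrank ℚ L :=
    two_pow_card_le_pow_finrank_of_den L S'⁻¹ hD hSi C₂ fun v hv => (Finset.mem_filter.1 hv).2
  have hP1 : 0 ≤ ∏ᶠ w, (GLn.localHeight (n + n) L w (h' : GL (Fin (n + n)) (AdeleRing (𝓞 L) L)) : ℝ) := finprod_nonneg fun _ => NNReal.coe_nonneg _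
  have hP2 : 0 ≤ ∏ᶠ w, (GLn.localHeight (n + n) L w (weylDelta L e dV hdV dW hdW : GL (Fin (n + n)) (AdeleRing (𝓞 L) L)) : ℝ) :=
    finprod_nonneg fun _ => NNReal.coe_nonneg _
  have hD0 : (0 : ℝ) ≤ (D : ℝ) ^ Module.finrank ℚ L := by positivity
  calc (2 : ℝ) ^ K.card ≤ (2 : ℝ) ^ (A.card + B.card + C₁.card + C₂.card) := pow_le_pow_right₀ one_le_two hcard
    _ = (2 : ℝ) ^ A.card * (2 : ℝ) ^ B.card * ((2 : ℝ) ^ C₁.card * (2 : ℝ) ^ C₂.card) := by rw [pow_add, pow_add, pow_add]; ring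
    _ ≤ (∏ᶠ w, (GLn.localHeight (n + n) L w (h' : GL (Fin (n + n)) (AdeleRing (𝓞 L) L)) : ℝ)) *
          (∏ᶠ w, (GLn.localHeight (n + n) L w (weylDelta L e dV hdV dW hdW : GL (Fin (n + n)) (AdeleRing (𝓞 L) L)) : ℝ)) *
            ((D : ℝ) ^ Module.finrank ℚ L * (D : ℝ) ^ Module.finrank ℚ L) := by
        gcongr
    _ = _ := by rw [← pow_add, two_mul]

end Head

end Summit.HodgeConjecture.HodgeConjecture.Cruxes.HLiu418.K2LiuKindWPlacesCount

end
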